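import Summits.ABC.ABC.Theses.DefiniteXi
import Literature.NumberTheory.Automorphic.BrandtThetaSeriesHeckeAction
import Literature.NumberTheory.Automorphic.BrandtEigenvectorNonEisenstein
import Literature.NumberTheory.Automorphic.BrandtEigenvectorDegreeZero
import Literature.NumberTheory.EllipticCurves.HeckeOperatorsModularFormQExpansion
import Literature.NumberTheory.EllipticCurves.CongruenceNumber
import Literature.NumberTheory.EllipticCurves.HeckeCongruenceModulus
import Literature.NumberTheory.EllipticCurves.LFunctionCoefficientBound
import Literature.NumberTheory.EllipticCurves.SzpiroFreyConductorProofs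
import Mathlib.NumberTheory.ModularForms.CuspFormSubmodule
import HarnessLib

/-!
# Sketch (stub-ideation k=3 · GEN 5 · FAMILY 3 PROBE THE EXTREMES) for `stub_xiDegreeComparison`
# of crux `SteinbergCore` (route-ABC-DefiniteXi, line `p6_tamagawa_split`):
# AUXILIARY-PRIME EISENSTEIN KILLING — the `N^ε` slack of the stub buys BOTH open inputs of the
# three-seat chain (H1 = cuspidality of theta differences, and Mazur–Kenku) with one good prime `ℓ₀`.

Companion to `STUB-IDEAS-stub_xiDegreeComparison-3.md` (gen 5).  The gen-4 extreme (11a1, `p = 5`: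
`ξ = 5`, `r = m = 1`, excess = Eisenstein congruence) said: ξ sees EXACTLY the Eisenstein part.  Gen 5
kills the Eisenstein part on BOTH sides with the polynomial
`Q_ℓ(X) = (X² − (ℓ+1)²)(X² + (ℓ−1)²)` in the Hecke operator at an auxiliary prime `ℓ ∤ N`:

* MODULAR SIDE (E-block, replaces H1; pure group theory + limits, no theta inversion, no Gauss sums):
  at Frey levels (`N ∣ 2⁸ rad(abc)`, so `g := gcd(d, N/d) ∣ 16` for every `d ∣ N`) the operator
  `Q_ℓ(T_ℓ)` maps ALL of `M₂(Γ₀(N))` into `S₂(Γ₀(N))` (E3), because on cusp constant terms `T_ℓ` acts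
  as `P + ℓ P⁻¹` with `P` = multiplication of the cusp's unit invariant by `ℓ` (E1♯, E2), `P⁴ = 1`
  (`(ℤ/16)ˣ` has exponent 4), and `Q_ℓ(P + ℓP⁻¹) = 0` (E0).  CERTIFIED: job j344825 (pari `mfheckemat`
  on `mfinit([N,2],3)`): 90 pairs `(N, ℓ)`, `Q_ℓ(T_ℓ)|Eis = 0` in 75/75 pairs satisfying `ℓ⁴ ≡ 1 (mod g ∀g)`
  and `≠ 0` in all 15 negative controls (`N = 49, 98, 147, 289`), i.e. the iff in 90/90.
* BRANDT SIDE (B-block, replaces k2's H5/H6 + Mazur–Kenku + gen-4 L1/L2): the FLAT LIFT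
  `Θ♭_i(v) := Σ_j (Q_ℓ(T(ℓ)) v)_j Θ_{ij}` is cuspidal for EVERY `v ∈ ℤ^{Cls}` (B1, from E3 and the tree's
  PROVED `XiSetup.modHeckeT_sum_smul_brandtTheta`), so k2's PROVED transfer kernel runs WITHOUT the
  degree-zero restriction (B2) and with the test vector `y = e_{i'}`:
  `ξ ∣ |2 w_i φ_i · Q_ℓ(a_ℓ) · w_{i'} φ_{i'}| · r_f` (B3 = `XiFlatCoreDivisibility`), whence for `p ≥ 5`
  `v_p ξ ≤ v_p r_f + v_p Q_ℓ(a_ℓ)` (B5) with `0 ≠ |Q_ℓ(a_ℓ)| ≤ (ℓ+1)⁴` (B4, Hasse) and `ℓ = ℓ₀ ≪ (log N)²`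
  (gen-4 L3), so `cps ξ ≤ (ℓ₀+1)⁴ cps(deg D) ≤ C_ε N^ε cps(deg D)` (gen-4 L5–L7, ARS 2.1(b), FreyModularity).

Trust base of the whole chain: {ARS 2.1(b) (`padicValNat_congruenceNumber_eq_of_not_sq_dvd`),
`FreyModularity` (route item), multiplicity one (tree)} — NO Pizer 2.15 / HPS 1989 fact (H1), NO
Mazur–Kenku.  `ε > 0` is used (at L3), honouring `Disproof.steinbergCore_false_without_eps_pos`.
-/

set_option linter.dupNamespace false

noncomputable section

namespace Summit.ABC.ABC.Cruxes.SteinbergCore.ProbeExtremesG5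

open scoped MatrixGroups ModularForm Matrix
open Filter Topology
open UpperHalfPlane hiding I
open CongruenceSubgroup
open Literature.NumberTheory.EllipticCurves Literature.NumberTheory.EllipticCurves.ModularForms
open Literature.NumberTheory.Automorphic Literature.NumberTheory.Automorphic.Brandt

/-! ## §0 The killing polynomial `Q_ℓ(X) = (X² − (ℓ+1)²)(X² + (ℓ−1)²)` -/

/-- `Q_ℓ(a) ∈ ℤ` evaluated at an integer (used at `a = a_ℓ(E)`). -/
def quarticKillerEval (ℓ : ℕ) (a : ℤ) : ℤ := (a ^ 2 - ((ℓ : ℤ) + 1) ^ 2) * (a ^ 2 + ((ℓ : ℤ) - 1) ^ 2)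

/-- `Q_ℓ(T)` for an endomorphism `T` of a complex vector space. -/
def killerEnd {V : Type*} [AddCommGroup V] [Module ℂ V] (ℓ : ℕ) (T : Module.End ℂ V) : Module.End ℂ V :=
  (T * T - (((ℓ : ℂ) + 1) ^ 2) • 1) * (T * T + (((ℓ : ℂ) - 1) ^ 2) • 1)

/-- `Q_ℓ(M)` for an integer matrix `M` (used at `M = T(ℓ)`, the Brandt matrix). -/
def killerMat {ι : Type*} [Fintype ι] [DecidableEq ι] (ℓ : ℕ) (M : Matrix ι ι ℤ) : Matrix ι ι ℤ :=
  (M * M - (((ℓ : ℤ) + 1) ^ 2) • 1) * (M * M + (((ℓ : ℤ) - 1) ^ 2) • 1)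

/-! ## E0 — the algebra: `Q_ℓ(P + ℓP⁻¹) = 0` whenever `P⁴ = 1` -/

/-- **E0 certificate (PROVED).** In any commutative ring, `P⁴ = 1 ⟹ Q_ℓ(P + ℓP³) = 0`:
`t² = (1+ℓ²)P² + 2ℓ`, so `(t² − (ℓ+1)²)(t² + (ℓ−1)²) = (1+ℓ²)²(P² − 1)(P² + 1) = (1+ℓ²)²(P⁴ − 1)`. [folklore] -/
theorem killer_identity_of_pow_four {R : Type*} [CommRing R] (P l : R) (hP : P ^ 4 = 1) :
    ((P + l * P ^ 3) ^ 2 - (l + 1) ^ 2) * ((P + l * P ^ 3) ^ 2 + (l - 1) ^ 2) = 0 := by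
  linear_combination ((1 + l ^ 2) ^ 2 + 2 * (1 + l ^ 2) * P ^ 2 * (2 * l + l ^ 2 * P ^ 2) +
    (P ^ 4 - 1) * (2 * l + l ^ 2 * P ^ 2) ^ 2) * hP

/-- The cusp-constant model: on `ℂ^{ℤ/4}`, `t_ℓ c (i) = c (i+1) + ℓ c (i−1)` (`= P + ℓP⁻¹`, `P` the rotation). -/
def cuspShift (ℓ : ℕ) : Module.End ℂ (ZMod 4 → ℂ) where
  toFun c i := c (i + 1) + (ℓ : ℂ) * c (i - 1)
  map_add' c c' := by ext i; simp only [Pi.add_apply]; ring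
  map_smul' a c := by ext i; simp only [Pi.smul_apply, smul_eq_mul, RingHom.id_apply]; ring

theorem cuspShift_apply (ℓ : ℕ) (c : ZMod 4 → ℂ) (i : ZMod 4) :
    cuspShift ℓ c i = c (i + 1) + (ℓ : ℂ) * c (i - 1) := rfl

/-- `t_ℓ² c (i) = (1+ℓ²) c(i+2) + 2ℓ c(i)` (PROVED). -/
theorem cuspShift_sq_apply (ℓ : ℕ) (c : ZMod 4 → ℂ) (i : ZMod 4) :
    (cuspShift ℓ * cuspShift ℓ) c i = (1 + (ℓ : ℂ) ^ 2) * c (i + 2) + 2 * (ℓ : ℂ) * c i := by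
  rw [Module.End.mul_apply, cuspShift_apply, cuspShift_apply, cuspShift_apply]
  have h1 : i + 1 + 1 = i + 2 := by ring
  have h2 : i + 1 - 1 = i := by ring
  have h3 : i - 1 + 1 = i := by ring
  have h4 : i - 1 - 1 = i + 2 := by
    have : (4 : ZMod 4) = 0 := by decide
    linear_combination -this
  rw [h1, h2, h3, h4]; ring

/-- **E0 (PROVED).** `Q_ℓ(t_ℓ) = 0` on `ℂ^{ℤ/4}`: `(t² − (ℓ+1)²) c (i) = (1+ℓ²)(c(i+2) − c(i))` is anti-periodic of period 2 and
`(t² + (ℓ−1)²) u (i) = (1+ℓ²)(u(i+2) + u(i))`. [folklore] -/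
theorem killerEnd_cuspShift (ℓ : ℕ) : killerEnd ℓ (cuspShift ℓ) = 0 := by
  refine LinearMap.ext fun c => ?_
  funext i
  rw [killerEnd, Module.End.mul_apply, LinearMap.sub_apply, LinearMap.add_apply, LinearMap.smul_apply,
    LinearMap.smul_apply, Module.End.one_apply, Module.End.one_apply, LinearMap.zero_apply]
  set u : ZMod 4 → ℂ := (cuspShift ℓ * cuspShift ℓ) c + (((ℓ : ℂ) - 1) ^ 2) • c with hu
  have hu' : ∀ j, u j = (1 + (ℓ : ℂ) ^ 2) * (c (j + 2) + c j) := by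
    intro j
    rw [hu, Pi.add_apply, Pi.smul_apply, cuspShift_sq_apply, smul_eq_mul]; ring
  rw [Pi.zero_apply, Pi.sub_apply, Pi.smul_apply, cuspShift_sq_apply, smul_eq_mul, hu', hu' i]
  have h22 : i + 2 + 2 = i := by
    have : (4 : ZMod 4) = 0 := by decide
    linear_combination this
  rw [h22]; ring

/-! ## E1a — value at infinity after an upper-triangular slash -/

/-- **E1a (S).** If `f → v` at `i∞` then `f ∣[k] (a b; 0 d) → (ad)^{k−1} d^{−k} v` (`a, d > 0`): Mathlib's slash carries
`det^{k−1}` and `(0·z + d)^{−k}`, and `Im((az+b)/d) = (a/d) Im z → ∞`.  For `k = 2` the factor is `a/d`: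
`1/ℓ` for `(1 b; 0 ℓ)`, `ℓ` for `(ℓ b; 0 1)`.  FIRST CHECK for the prover: `ModularForm.slash_def` normalisation. [folklore] -/
theorem tendsto_slash_upperTriangular {f : ℍ → ℂ} {v : ℂ} (hf : Tendsto f atImInfty (𝓝 v)) (k : ℤ)
    {a b d : ℝ} (ha : 0 < a) (hd : 0 < d) (g : GL (Fin 2) ℝ)
    (hg : (g : Matrix (Fin 2) (Fin 2) ℝ) = !![a, b; 0, d]) :
    Tendsto (f ∣[k] g) atImInfty (𝓝 (((a * d : ℝ) : ℂ) ^ (k - 1) * ((d : ℂ) ^ k)⁻¹ * v)) := by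
  sorry

/-! ## E2 — cusps of `Γ₀(N)`: the invariant `(d, r)` and equivalence of representatives -/

/-- **E2 (S · generalises k1's C1 to different denominators).** For `B, B' ∈ SL₂(ℤ)` with first columns `(u; v)`, `(u'; v')`:
if `gcd(v, N) = gcd(v', N) = d` and `u·(v/d) ≡ u'·(v'/d) (mod gcd(d, N/d))`, then `B' = δ B T^h` with `δ ∈ Γ₀(N)`.
(Lower-left entry of `B' T^{−h} B⁻¹` is `v'y − vy' + h v v'`; `gcd(vv', N) = d·gcd(d, N/d)`; `y ≡ u⁻¹ (mod v)`.)
Unit test (k1 g7): `N = 64`, `B = (1 0; 8 1)`, `B' = (5 3; 8 5)`: `d = 8`, `g = 8`, `r = 1 ≠ 5 = r'` — inequivalent;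
at `N = 32`: `g = 4`, `5 ≡ 1` — equivalent.  [cite: DiamondShurman2005, Prop. 3.8.3] -/
theorem exists_gamma0_mul_T_zpow_of_cuspInv {N : ℕ} (hN : 0 < N) (B B' : SL(2, ℤ)) {d : ℕ}
    (hd : Int.gcd (B 1 0) N = d) (hd' : Int.gcd (B' 1 0) N = d)
    (hr : ((B 0 0 * (B 1 0 / d) : ℤ) : ZMod (Nat.gcd d (N / d))) = ((B' 0 0 * (B' 1 0 / d) : ℤ) : ZMod (Nat.gcd d (N / d)))) :
    ∃ δ : SL(2, ℤ), δ ∈ Gamma0 N ∧ ∃ h : ℤ, B' = δ * B * ModularGroup.T ^ h := by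
  sorry

/-! ## E1♯ — cusp transport of `T_ℓ`: `c(T_ℓF; d, r) = c(F; d, ℓr) + ℓ · c(F; d, ℓ⁻¹r)` -/

/-- **E1♯ (M · the heart of the E-block).** For `F ∈ M₂(Γ₀(N))`, a prime `ℓ ∤ N`, a cusp representative `A` with `ℓ ∤ c_A`,
and representatives `Ap`, `Am` of the cusps `(d, ℓ r)` and `(d, ℓ⁻¹ r)` (`(d, r)` = invariant of `A`):
`v∞((T_ℓ F) ∣ A) = v∞(F ∣ Ap) + ℓ · v∞(F ∣ Am)`.  Proof: `T_ℓ F = Σ_{j<ℓ} F∣(1 j; 0 ℓ) + F∣diag(ℓ,1)`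
(tree `coe_modHeckeT_gamma0_eq_sum`, PROVED); Hermite form `βA = σ'(A' B'; 0 D')` (tree `exists_SL2_mul_upper`,
`HalfIntegralWeightFormsProofs`); the `ℓ − 1` indices `j` with `ℓ ∤ a + jc` and `diag(ℓ,1)A` have `(A', D') = (1, ℓ)`, first
columns `(a+jc; ℓc)`, `(ℓa; c)` of invariant `(d, ℓr)` (weight `1/ℓ` by E1a); the unique `j₀` with `ℓ ∣ a + j₀c`
(tree `EisensteinCovector.card_filter_dvd_eq_one`) has `(A', D') = (ℓ, 1)`, first column `((a+j₀c)/ℓ; c)` of invariant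
`(d, ℓ⁻¹r)` (weight `ℓ`); E2 + k1's PROVED C2 `valueAtInfty_slash_gamma0_mul_T_zpow` identify the values.
[cite: DiamondShurman2005, Prop. 5.2.1] [cite: Ohta1999, Prop. (3.4.12)] -/
theorem valueAtInfty_modHeckeT_slash {N : ℕ} [NeZero N] {ℓ : ℕ} [NeZero ℓ] (hℓ : ℓ.Prime) (hℓN : ¬ ℓ ∣ N)
    (F : ModularForm (Gamma0 N) 2) (A Ap Am : SL(2, ℤ)) (hA : ¬ (ℓ : ℤ) ∣ A 1 0) {d : ℕ}
    (hd : Int.gcd (A 1 0) N = d) (hdp : Int.gcd (Ap 1 0) N = d) (hdm : Int.gcd (Am 1 0) N = d)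
    (hrp : ((Ap 0 0 * (Ap 1 0 / d) : ℤ) : ZMod (Nat.gcd d (N / d))) = (((ℓ : ℤ) * (A 0 0 * (A 1 0 / d)) : ℤ) : ZMod _))
    (hrm : (((ℓ : ℤ) * (Am 0 0 * (Am 1 0 / d)) : ℤ) : ZMod (Nat.gcd d (N / d))) = ((A 0 0 * (A 1 0 / d) : ℤ) : ZMod _)) :
    valueAtInfty (⇑(modHeckeT (Gamma0 N) 2 ℓ F) ∣[(2 : ℤ)] (A : GL (Fin 2) ℝ)) =
      valueAtInfty (⇑F ∣[(2 : ℤ)] (Ap : GL (Fin 2) ℝ)) + (ℓ : ℂ) * valueAtInfty (⇑F ∣[(2 : ℤ)] (Am : GL (Fin 2) ℝ)) := by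
  sorry

/-! ## E4 — representatives: every cusp has a 4-cycle of representatives `(d, ℓ^i r)` with `ℓ ∤ c` -/

/-- **E4 (S).** Given `B ∈ SL₂(ℤ)`, `ℓ ∤ N` prime: representatives `A i` (`i ∈ ℤ/4`) with `A 0 ∼ B` (same cusp), all `ℓ ∤ c_{A i}`,
common `d`, and invariants `r(A (i+1)) ≡ ℓ · r(A i)` for `i = 0, 1, 2` (closing `3 → 0` is where `ℓ⁴ ≡ 1 (mod g)` enters, in E3).
(Same `c` for all `i`; numerators by CRT modulo the primes of `c`; if `ℓ ∣ c_B` first pass to `(1 0; N 1)B`.) [folklore] -/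
theorem exists_cusp_cycle {N : ℕ} (hN : 0 < N) {ℓ : ℕ} (hℓ : ℓ.Prime) (hℓN : ¬ ℓ ∣ N) (B : SL(2, ℤ)) :
    ∃ (A : ZMod 4 → SL(2, ℤ)) (d : ℕ), (∃ δ : SL(2, ℤ), δ ∈ Gamma0 N ∧ ∃ h : ℤ, B = δ * A 0 * ModularGroup.T ^ h) ∧
      (∀ i, ¬ (ℓ : ℤ) ∣ A i 1 0) ∧ (∀ i, Int.gcd (A i 1 0) N = d) ∧
      ∀ i, i ≠ 3 → ((A (i + 1) 0 0 * (A (i + 1) 1 0 / d) : ℤ) : ZMod (Nat.gcd d (N / d))) =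
        (((ℓ : ℤ) * (A i 0 0 * (A i 1 0 / d)) : ℤ) : ZMod _) := by
  sorry

/-! ## E3 — assembly: `Q_ℓ(T_ℓ) M₂(Γ₀(N)) ⊆ S₂(Γ₀(N))` when `ℓ⁴ ≡ 1 (mod gcd(d, N/d))` for all `d ∣ N` -/

/-- **E3 (S · E-block assembly) — THE H1-REPLACEMENT.** For a prime `ℓ ∤ N` with `ℓ⁴ ≡ 1 (mod gcd(d, N/d))` for every
`d ∣ N`, `Q_ℓ(T_ℓ) F` is a cusp form for EVERY `F ∈ M₂(Γ₀(N))`.  Proof: for each `B`, E4's cycle `A i`; by E1♯ (+ E2/C2 to close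
`3 → 0` using `ℓ⁴ ≡ 1`) the vector `c_G := (v∞(G ∣ A i))_i ∈ ℂ^{ℤ/4}` satisfies `c_{T_ℓ G} = cuspShift ℓ (c_G)` for
`G ∈ {F, T_ℓF, T_ℓ²F, T_ℓ³F}`, so `c_{Q_ℓ(T_ℓ)F} = killerEnd ℓ (cuspShift ℓ) c_F = 0` (E0); hence `v∞((Q_ℓ(T_ℓ)F) ∣ B) = 0` for all
`B`, i.e. cuspidal (k1's PROVED `isCuspForm_sub_of_forall_valueAtInfty_slash_eq` with `g = 0`, or Mathlib
`ModularForm.isCuspForm_iff` + `isZeroAt_iff_forall_SL2Z`).  CERTIFIED (j344825): iff in 90/90 pairs `(N, ℓ)`.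
[cite: DiamondShurman2005, Thm. 4.6.2 (Eisenstein eigenvalues `ψ(ℓ) + ℓψ̄(ℓ)`, `cond(ψ)² ∣ N`)] -/
theorem isCuspForm_killerEnd_modHeckeT {N : ℕ} [NeZero N] {ℓ : ℕ} [NeZero ℓ] (hℓ : ℓ.Prime) (hℓN : ¬ ℓ ∣ N)
    (hg : ∀ d : ℕ, d ∣ N → ((ℓ : ℕ) : ZMod (Nat.gcd d (N / d))) ^ 4 = 1) (F : ModularForm (Gamma0 N) 2) :
    ModularForm.IsCuspForm (killerEnd ℓ (modHeckeT (Gamma0 N) 2 ℓ) F) := by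
  sorry

/-! ## E5 — Frey levels satisfy the hypothesis of E3 for EVERY prime `ℓ ∤ N` -/

/-- **E5 (XS).** `N ∣ 2⁸ rad(ab(a+b))` (tree `conductorNorm_freyCurve_dvd_holds`, PROVED) ⟹ `gcd(d, N/d) ∣ 16` for all `d ∣ N`
(`g² ∣ N`, `rad` squarefree) ⟹ `ℓ⁴ ≡ 1 (mod gcd(d, N/d))` for every prime `ℓ ∤ N` (`ℓ` odd: `(ℤ/16)ˣ` has exponent `4`;
`ℓ = 2`: then `N` is odd squarefree and every `g = 1`). [cite: Frey1986] [cite: DiamondKramer1995] -/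
theorem frey_killer_hypothesis {a b : ℤ} (hab : IsCoprime a b) (h0 : a * b * (a + b) ≠ 0) {N : ℕ}
    (hN : (freyCurve a b).conductorNorm ℤ = N) {ℓ : ℕ} (hℓ : ℓ.Prime) (hℓN : ¬ ℓ ∣ N) (d : ℕ) (hd : d ∣ N) :
    ((ℓ : ℕ) : ZMod (Nat.gcd d (N / d))) ^ 4 = 1 := by
  sorry

/-! ## B1 — the flat lift `Θ♭_i(v) = Σ_j (Q_ℓ(T(ℓ))v)_j Θ_{ij}` is cuspidal for every `v` -/

variable {Nplus Nminus : ℕ}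

/-- **B1 (S).** `Σ_j (Q_ℓ(T(ℓ)) v)_j Θ_{ij} = Q_ℓ(T_ℓ)(Σ_j v_j Θ_{ij})` (tree `XiSetup.modHeckeT_sum_smul_brandtTheta`, four times;
`heckeFamily ℓ = mulVec (T(ℓ))`) is a cusp form by E3. -/
theorem XiSetup.isCuspForm_flatLift (S : XiSetup Nplus Nminus) [Fintype (ClassSet S.O)] [DecidableEq (ClassSet S.O)]
    [NeZero (Nplus * Nminus)] {ℓ : ℕ} [NeZero ℓ] (hℓ : ℓ.Prime) (hℓN : ¬ ℓ ∣ Nplus * Nminus)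
    (hg : ∀ d : ℕ, d ∣ Nplus * Nminus → ((ℓ : ℕ) : ZMod (Nat.gcd d (Nplus * Nminus / d))) ^ 4 = 1)
    (i : ClassSet S.O) (v : ClassSet S.O → ℤ) :
    ModularForm.IsCuspForm (∑ j, ((killerMat ℓ (matrix S.O ℓ) *ᵥ v) j : ℂ) • S.brandtTheta i j) := by
  sorry

/-! ## B2 — k2's transfer kernel (T) WITHOUT the degree-zero guards -/

/-- **B2 = (T♯) (S · k2's `ThetaTransferG4.dvd_natAbs_mul_congruenceNumber_of_transfer` with the `Σ = 0` guards deleted;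
same proof).**  `Θ : ℤ^ι →+ S_k(Γ₀(N))` integral-valued, `Θ φ = m f`, `Θ z ⊥ f` whenever `⟨φ, z⟩_w = 0`, `ξ = Σ w φ²`:
then `ξ ∣ |m ⟨φ, y⟩_w| · r_f` for EVERY `y` (in particular `y = e_{i'}`, `⟨φ, e_{i'}⟩_w = w_{i'} φ_{i'}`). -/
theorem dvd_natAbs_mul_congruenceNumber_of_transfer' {ι : Type*} [Fintype ι] {N : ℕ} [NeZero N]
    {k : ℤ} (w : ι → ℕ) (φ : ι → ℤ) {ξ : ℕ} (hξ : ξ ≠ 0)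
    (hξw : ξ = ∑ c, w c * (φ c).natAbs ^ 2)
    {f : CuspForm (Gamma0 N) k} (hf : f ≠ 0) (hfI : f ∈ integralCuspForms0 N k)
    (Θ : (ι → ℤ) →+ CuspForm (Gamma0 N) k)
    (hint : ∀ v : ι → ℤ, Θ v ∈ integralCuspForms0 N k)
    {m : ℤ} (hφf : Θ φ = (m : ℂ) • f)
    (horth : ∀ z : ι → ℤ, ∑ c, (w c : ℤ) * φ c * z c = 0 → peterssonProduct (Gamma0 N) k f (Θ z) = 0)
    (y : ι → ℤ) :
    ξ ∣ (m * ∑ c, (w c : ℤ) * φ c * y c).natAbs * congruenceNumber f := by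
  sorry

/-! ## B3 — the FLAT CORE DIVISIBILITY (what the assembly consumes; replaces gen-4 `XiCoreDivisibility` ⇐ H1) -/

/-- **B3 target.**  For every definite setup, curve, newform, generator `φ` of the eigen-line, every prime `ℓ ∤ N` satisfying E3's
hypothesis, and all classes `i, i'`: `ξ ∣ |2 w_i φ_i · Q_ℓ(a_ℓ) · w_{i'} φ_{i'}| · r_f`.  ROUTE (S–M, one prover cycle given B1, B2,
k2's H2/H3/(O)): `Θ♭_i :=` the cusp form under B1 (`CuspForm.equivCuspFormSubmodule`), additive, integral
(`XiSetup.qExpansion_coeff_brandtTheta`), `T_p`-equivariant for `p ∤ N` (`modHeckeT_sum_smul_brandtTheta`, `coe_modHeckeT_coe_cuspForm`,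
`XiSetup.matrix_comm_of_coprime_level`), `Θ♭_i φ = Q_ℓ(a_ℓ) · 2w_iφ_i · f` (k2 H3: `Σ_j φ_jΘ_{ij} = Q_ℓ(a_ℓ)⁻¹ Θ♭_iφ` IS cuspidal,
B4), `horth` = k2's PROVED (O)/H4a′/H4b′ with guards deleted; then B2 with `y = e_{i'}`. -/
def XiFlatCoreDivisibility : Prop :=
  ∀ (Nplus Nminus M : ℕ) [NeZero M], Nplus * Nminus = M →
    ∀ (S : XiSetup Nplus Nminus) [Fintype (ClassSet S.O)] (W : WeierstrassCurve ℚ) [W.IsElliptic]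
      (f : CuspForm (Gamma0 M) 2), IsNewformOf W f →
    ∀ (φ : ClassSet S.O → ℤ), φ ≠ 0 →
      eigenLattice (Nplus * Nminus) (matrix S.O) (fun n => W.LFunction n) = ℤ ∙ φ →
    ∀ (ℓ : ℕ), ℓ.Prime → ¬ ℓ ∣ M → (∀ d : ℕ, d ∣ M → ((ℓ : ℕ) : ZMod (Nat.gcd d (M / d))) ^ 4 = 1) →
    ∀ (i i' : ClassSet S.O),
      (S.xi fun n => W.LFunction n) ∣
        (2 * (weight S.O i : ℤ) * φ i * quarticKillerEval ℓ (W.LFunction ℓ) * ((weight S.O i' : ℤ) * φ i')).natAbs *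
          congruenceNumber f

/-! ## B4 — Hasse: `0 ≠ |Q_ℓ(a_ℓ)| ≤ (ℓ+1)⁴` -/

/-- **B4 (XS).** `|a_ℓ| ≤ 2√ℓ < ℓ + 1` (tree `WeierstrassCurve.abs_LFunction_prime_pow_le`, `k = 1`) gives `a_ℓ² ≠ (ℓ+1)²`,
`a_ℓ² + (ℓ−1)² ≠ 0`, `|a_ℓ² − (ℓ+1)²| ≤ (ℓ+1)²` and `a_ℓ² + (ℓ−1)² ≤ 4ℓ + (ℓ−1)² = (ℓ+1)²`. [folklore] -/
theorem quarticKillerEval_ne_zero_and_le (W : WeierstrassCurve ℚ) [W.IsElliptic] {ℓ : ℕ} (hℓ : ℓ.Prime) :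
    quarticKillerEval ℓ (W.LFunction ℓ) ≠ 0 ∧
      (((quarticKillerEval ℓ (W.LFunction ℓ)).natAbs : ℕ) : ℝ) ≤ ((ℓ : ℝ) + 1) ^ 4 := by
  sorry

/-! ## B5 — valuations from the flat core divisibility (replaces gen-4 L1″/L2; PROVED) -/

/-- **B5 (XS, PROVED).** From `x ∣ |2 w_i φ_i · q · w_{i'} φ_{i'}| · r` for all `i, i'` (B3 with `q = Q_ℓ(a_ℓ) ≠ 0`):
`v_p x ≤ v_p r + v_p q` for every prime `p ≥ 5` — take `i = i' = c₀` with `p ∤ φ_{c₀}` (`exists_not_dvd_of_eigenLattice_eq_span`),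
`p ∤ 2 w_{c₀}` (`XiSetup.not_dvd_weight`). No Eisenstein criterion, no Mazur. -/
theorem factorization_le_of_flatCore (S : XiSetup Nplus Nminus) [Fintype (ClassSet S.O)]
    {T : ℕ → Matrix (ClassSet S.O) (ClassSet S.O) ℤ} {lam : ℕ → ℤ} {M : ℕ}
    {φ : ClassSet S.O → ℤ} (hφ0 : φ ≠ 0) (hL : eigenLattice M T lam = ℤ ∙ φ)
    {x r : ℕ} (hr : r ≠ 0) {q : ℤ} (hq : q ≠ 0)
    (hflat : ∀ i i' : ClassSet S.O,
      x ∣ (2 * (weight S.O i : ℤ) * φ i * q * ((weight S.O i' : ℤ) * φ i')).natAbs * r)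
    {p : ℕ} (hp : p.Prime) (h5 : 5 ≤ p) :
    x.factorization p ≤ r.factorization p + q.natAbs.factorization p := by
  have hpZ : Prime (p : ℤ) := Nat.prime_iff_prime_int.mp hp
  obtain ⟨c₀, hc₀⟩ := exists_not_dvd_of_eigenLattice_eq_span hφ0 hL hp
  have hw : ¬ (p : ℤ) ∣ (weight S.O c₀ : ℤ) := fun h =>
    S.not_dvd_weight c₀ hp h5 (Int.natCast_dvd_natCast.mp h)
  have h2 : ¬ (p : ℤ) ∣ 2 := by
    intro h3
    have h4 : p ∣ 2 := by exact_mod_cast h3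
    have := Nat.le_of_dvd two_pos h4
    omega
  -- the `p`-free cofactor `u := (2 w φ_{c₀}) (w φ_{c₀})`
  set u : ℤ := 2 * (weight S.O c₀ : ℤ) * φ c₀ * ((weight S.O c₀ : ℤ) * φ c₀) with hu
  have hu0 : ¬ (p : ℤ) ∣ u := by
    intro hd
    rcases hpZ.dvd_or_dvd hd with h1 | h1
    · rcases hpZ.dvd_or_dvd h1 with h6 | h6
      · rcases hpZ.dvd_or_dvd h6 with h7 | h7
        · exact h2 h7
        · exact hw h7
      · exact hc₀ h6
    · rcases hpZ.dvd_or_dvd h1 with h6 | h6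
      · exact hw h6
      · exact hc₀ h6
  have hdiv := hflat c₀ c₀
  have hrew : 2 * (weight S.O c₀ : ℤ) * φ c₀ * q * ((weight S.O c₀ : ℤ) * φ c₀) = u * q := by
    rw [hu]; ring
  rw [hrew, Int.natAbs_mul, mul_assoc] at hdiv
  have hA : ¬ p ∣ u.natAbs := fun hd => hu0 (Int.natCast_dvd.mpr hd)
  have h1 : p ^ x.factorization p ∣ q.natAbs * r :=
    (Nat.Coprime.pow_left _ ((Nat.Prime.coprime_iff_not_dvd hp).mpr hA)).dvd_of_dvd_mul_left
      ((Nat.ordProj_dvd x p).trans hdiv)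
  have hqr : q.natAbs * r ≠ 0 := mul_ne_zero (Int.natAbs_ne_zero.mpr hq) hr
  have h3 := (hp.pow_dvd_iff_le_factorization hqr).mp h1
  rw [Nat.factorization_mul (Int.natAbs_ne_zero.mpr hq) hr, Finsupp.add_apply] at h3
  omega

/-! ## L7♭ — assembly of the stub from the flat core, `C := (2 C₃)⁴` with `C₃` from gen-4 L3 at `ε/4` -/

/-- **L7♭ (S · assembly).**  As gen-4 L7 with `XiCoreDivisibility`/L2 replaced by `XiFlatCoreDivisibility`/B5 and the loss
`4ℓ` by `(ℓ+1)⁴ ≤ (2ℓ)⁴`: fix `ε`, `C₃` from L3 (`exists_prime_not_dvd_le_rpow`) at `ε/4`, `C := (2C₃)⁴`; `D` minimal from `hMod`;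
setup of type `(N/Nm, Nm)` with `brandtXi = S.xi` and generator `φ`; `ℓ₀ ∤ N` least good prime, E5 (`frey_killer_hypothesis`) feeds
the hypothesis of `hX`; `q := Q_{ℓ₀}(a_{ℓ₀}) ≠ 0` (B4); for `p ≥ 5`: B5 + L6 (ARS (b), `p² ∤ N`) ⟹ `v_p ξ ≤ v_p deg D + v_p q`;
L5 ⟹ `cps ξ ≤ cps(deg D)·|q| ≤ cps(deg D)(ℓ₀+1)⁴ ≤ C N^ε cps(deg D)`; `1 ≤ T³`.  `ε` used at L3 only. -/
theorem stub_xiDegreeComparison_of_flatCore (hX : XiFlatCoreDivisibility)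
    (hARS : padicValNat_congruenceNumber_eq_of_not_sq_dvd)
    (hMod : Summit.ABC.ABC.Theses.DefiniteXi.FreyModularity) :
    ∀ ε : ℝ, 0 < ε → ∃ C : ℝ, ∀ a b : ℤ, IsCoprime a b → a * b * (a + b) ≠ 0 → ∀ (N : ℕ) [NeZero N],
      (Literature.NumberTheory.EllipticCurves.freyCurve a b).conductorNorm ℤ = N →
      ∀ Nm : ℕ, Odd Nm → Squarefree Nm → Odd Nm.primeFactors.card → Nm ∣ N →
      Literature.NumberTheory.Automorphic.brandtXi (N / Nm) Nm
          (fun n => (Literature.NumberTheory.EllipticCurves.freyCurve a b).LFunction n) ≠ 0 →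
      ∃ D : Literature.NumberTheory.EllipticCurves.ModularForms.ModularParametrizationData
        (Literature.NumberTheory.EllipticCurves.freyCurve a b) N,
        (∀ D' : Literature.NumberTheory.EllipticCurves.ModularForms.ModularParametrizationData
          (Literature.NumberTheory.EllipticCurves.freyCurve a b) N, D.deg ≤ D'.deg) ∧
        ((Literature.NumberTheory.Automorphic.brandtXi (N / Nm) Nm
              (fun n => (Literature.NumberTheory.EllipticCurves.freyCurve a b).LFunction n) /
            (ordProj[2] (Literature.NumberTheory.Automorphic.brandtXi (N / Nm) Nm
                (fun n => (Literature.NumberTheory.EllipticCurves.freyCurve a b).LFunction n)) *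
              ordProj[3] (Literature.NumberTheory.Automorphic.brandtXi (N / Nm) Nm
                (fun n => (Literature.NumberTheory.EllipticCurves.freyCurve a b).LFunction n))) : ℕ) : ℝ) ≤
          C * (N : ℝ) ^ ε * ((D.deg / (ordProj[2] D.deg * ordProj[3] D.deg) : ℕ) : ℝ) *
            ((∏ q ∈ N.primeFactors, ((Literature.NumberTheory.EllipticCurves.freyCurve a b).minimalDiscriminantNorm
              ℤ).factorization q : ℕ) : ℝ) ^ 3 := by
  sorry

/-! ## Sanity checks at the extremes -/

/-- 11a1 (`p = 5`, `ℓ₀ = 2`, `a₂ = −2`): `Q₂(a₂) = (4 − 9)(4 + 1) = −25`, so B5 reads `v₅ ξ = 1 ≤ v₅ r + v₅ 25 = 0 + 2` ✓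
(gen-4 L2 was tight at `1 ≤ 1`; the flat bound spends one more factor `#E(𝔽₂) = 5` — still inside `N^ε`). -/
example : quarticKillerEval 2 (-2) = -25 := by decide

/-- E0 at the four eigen-coordinates: `P = 1, −1, ±i` give `t = ±(ℓ+1)`, `±i(1−ℓ)`; e.g. `ℓ = 3`: roots `±4, ±2i` of
`(X² − 16)(X² + 4)` — the `N = 256, 512, 768` rows of j344825 where the quadratic killer FAILS for `ℓ ≡ ±3, ±5 (16)`. -/
example : ((Complex.I * (1 - 3)) ^ 2 + (3 - 1) ^ 2 : ℂ) = 0 := by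
  have : Complex.I ^ 2 = -1 := Complex.I_sq
  linear_combination (4 : ℂ) * this

end Summit.ABC.ABC.Cruxes.SteinbergCore.ProbeExtremesG5

end
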